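import Summits.CriticalPhenomena.PercolationContinuityZ3.Theorems.PercNearOneGluingNoHeavyLowerTailSunflowerHallGladkovProof
import Summits.CriticalPhenomena.PercolationContinuityZ3.Theorems.PercNearOneGluingNoHeavyLowerTailSunflowerHallGladkovSandwich
import HarnessLib
import HarnessLib.Audit

/-!
# `NoHeavyLowerTail` (crux stmt-CriticalPhenomena-4575), abstract sunflower cubic: the normal-form matching conjecture `HallGladkovNF` holds

Seat `prim-l12-p2` gen 17 (`--supports stmt-CriticalPhenomena-4575`).  No `sorry`, no new definitions.
`HallGladkovNF` (gen 16, `…SunflowerHallGladkovSandwich`: HALL–GLADKOV for pairs of up-sets in normal form, every minimal set of `V₁` outside `V₂`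
and vice versa) is equivalent to `HallGladkov` (`hallGladkov_iff_hallGladkovNF`), which is now a theorem (`hallGladkov_holds`,
`…SunflowerHallGladkovProof`, GF(2) rank argument).  This file records the discharge.
-/

namespace Summit.CriticalPhenomena.PercolationContinuityZ3.Theorems.SunflowerPartition

/-- **`HallGladkovNF` HOLDS** (this work): the normal-form Hall–Gladkov matching statement, from `hallGladkov_holds`. [this work] -/
theorem HallGladkov.hallGladkovNF_holds : HallGladkov.HallGladkovNF := HallGladkov.hallGladkov_iff_hallGladkovNF.1 hallGladkov_holds

end Summit.CriticalPhenomena.PercolationContinuityZ3.Theorems.SunflowerPartition
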